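import Summits.QuantumFields.QCD.Theorems.NestedDissectionSeaRobustYangMillsStubDeployment
import Summits.QuantumFields.QCD.Theorems.RobustYangMills.Negative.NoSmallFalse

/-!
# Line `local-ac-open-certificate` for the crux `RobustYangMills` (stmt-QuantumFields-13897) —
# the renormalised-field leg `RenormalisedLeg` (statement of the OPEN stub `stub_renormalisedLeg`)
# and its size against the tree

Crux: `Summit.QuantumFields.QCD.Theses.NestedDissectionSea.RobustYangMills` (shared verbatim with
`HeavyThresholdYMBridge` / `AdaptiveBlockFermions`); checked skeleton
`Cruxes/RobustYangMills/Lines/local-ac-open-certificate.lean` (§4 `Legs`). Companion modules: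
`NestedDissectionSeaRobustYangMillsLocalAC` (§0–§1: `Family`, `AdmAt`, `ClauseConv`,
`ClauseLipOff`, `sch`, `r₃`, `stub_localAC`), `NestedDissectionSeaRobustYangMillsStubDeployment`
(§3: `IRConeClustering`, `RangeControl`) and the negative-side extract
`RobustYangMills/Negative/NoSmallFalse` (`WilsonConsequences`, `robustYangMills_imp_wilson`,
`eventually_nonneg_of_af`).

This module carries, verbatim from the skeleton, the Prop `RenormalisedLeg` (statement of the OPEN,
YM-hard stub `stub_renormalisedLeg`: given uniform IR clustering of the cone at `(η₁, κ, c₁)`, a budget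
`η₂ ≤ η₁` below which every admissible family in the IR regime `Λ'ℓ₀ ≥ c₁` has a subsequential OS
limit of all renormalised species with non-trivial non-Gaussian curvature, a mass gap, and clause
(iv) on `⁰𝒮`), and makes its SIZE durable by two kernel-checked consequences (plus the
monotonicity of its hypothesis):

* `wilsonContinuum_of_renormalisedLeg_of_clustering` — in the line's vocabulary: the leg at
  `η = 0`, `W ≡ 0` (the zero family is admissible eventually in `k`, `eventually_admAt_zeroFamily`:
  (h1) totals of `0` are invariant, (h2) odd-torus reflection positivity of Wilson's measure at
  `β'_k ≥ 0` eventually (`isReflectionPositive_zero_all`, `eventually_nonneg_of_af`), (h3)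
  `normLE_zero`, (h4) vacuous) gives, for every IR block scale, a subsequential OS continuum limit
  `T` of the PURE `SU(3)` Wilson theory with (i′), (ii) and an OS mass gap;
* `wilsonConsequences_of_renormalisedLeg_of_clustering` — in the tree's vocabulary: the leg together
  with its own hypothesis `IRConeClustering η₁ κ c₁` (any `η₁, κ, c₁ > 0`) implies
  `Negative.WilsonConsequences a L ha ha₀ haL β'` for ALL scaling data and ALL a.f. coupling
  sequences — exactly the package `robustYangMills_imp_wilson` extracts from the whole crux
  (subsequential OS limit of all species on `⁰𝒮`, non-trivial non-Gaussian curvature,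
  `HasMassGap Δ` and `HasLatticeMassGap Δ` at one `Δ > 0`): the block scale is eliminated by
  `ℓ₀ := c₁/Λ'` (`perturbedLatticeSchwinger_zero`: at `W ≡ 0` nothing depends on `ℓ₀`), the lattice
  gap is the clustering hypothesis read at the cone's vertex `w = 0` (`connectedCorr_zero`,
  `hasLatticeMassGap_of_irConeClustering`), and the two rates are reconciled by antitonicity
  (`osMassGap_anti`, `latticeMassGap_anti`);
* `IRConeClustering.mono` — the leg's hypothesis is antitone in the budget `η₁` and monotone in
  the rate `κ` and the IR scale `c₁` (clustering at `(η₁, κ, c₁)` serves every smaller budget).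

So the leg, granted the line's own deliverable (uniform IR clustering), contains Clay-type
existence + mass gap for pure `SU(3)` Wilson Yang–Mills along every a.f. sequence; it is filed OPEN.

Sources: Jaffe–Witten (2000) §§4–6; Osterwalder–Schrader, CMP 42 (1975); Osterwalder–Seiler,
Ann. Phys. 110 (1978) §2; Glimm–Jaffe (1987) §6.1, §19; Seiler, LNP 159 (1982) Ch. 2.
-/

set_option autoImplicit false

noncomputable section

namespace Summit.QuantumFields.QCD.Cruxes.RobustYangMills.LocalAcOpenCertificate

open scoped BigOperators Topology ENNReal
open Filter MeasureTheory
open Literature.MathematicalPhysics.QuantumLattice Literature.MathematicalPhysics.AQFT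
  Literature.MathematicalPhysics.QuantumFieldTheory
open Summit.QuantumFields.QCD.Theorems.RobustYangMills.Negative (WilsonConsequences
  eventually_nonneg_of_af isReflectionPositive_zero_all)

/-! ## §4 (part) The renormalised-field leg (statement of `stub_renormalisedLeg`) -/

/-- **Renormalised-field leg on `⁰𝒮`** (statement of `stub_renormalisedLeg`; NOT this line's mechanism —
it carries the `W ≡ 0` Clay core (Disproof §5: the crux implies OS existence + gap for pure `SU(3)`
Wilson along every a.f. sequence), the WASHING/rigidity input of the companion lines (admissible `W`
have per-site diluted response, so the `a_k^{-4}`-renormalised species of `μ_{β',W}` are asymptotically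
those of Wilson at a shifted a.f. coupling; triage r1-2 App. C, r1-3 on axis-markov-response), FULL
EUCLIDEAN INVARIANCE E1 of the limit (OPEN for cone members; `OSData` bundles E1), the gap transfer
(odd-torus RP transfer matrix from (h2) + clustering with constants UNIFORM over the cone ⇒ spectral gap
⇒ `HasMassGap` via E0′ — OneCertifiedCube.GapToContinuum, stmt-8896, whose pair-dependent-constant
caveat is answered by the uniformity of `IRConeClustering`) and the Lipschitz response ON `⁰𝒮` (polymer
expansion of `e^{-(W'-W)}`, KP-small by `NormLE κ δ`, around the clustering measure `μ_{β',W}` — BCO-type,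
no interpolation in `W` since the RP cone is not star-shaped — plus washing of admissible differences):
given uniform IR clustering of the cone at `(η₁, κ, c₁)` there is a budget `η₂ ≤ η₁` such that every
family admissible with `(κ, η ≤ η₂)` in the IR regime has a subsequential OS limit of all renormalised
species with non-trivial non-Gaussian curvature ((i′), (ii)), a mass gap, and clause (iv) on `⁰𝒮`. -/
def RenormalisedLeg : Prop :=
  ∀ (η₁ κ c₁ : ℝ), 0 < η₁ → 0 < κ → 0 < c₁ → IRConeClustering η₁ κ c₁ →
    ∃ η₂ : ℝ, 0 < η₂ ∧ η₂ ≤ η₁ ∧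
    ∀ (a : ℕ → ℝ) (L : ℕ → ℕ) (ha : ∀ k, 0 < a k) (ha₀ : Tendsto a atTop (𝓝 0))
      (haL : Tendsto (fun k => a k * L k) atTop atTop) (β' : ℕ → ℝ) (Λ' : ℝ), 0 < Λ' →
      Tendsto (fun k => β' k - afBeta 0 Λ' (a k)) atTop (𝓝 0) →
    ∀ ℓ₀ : ℝ, c₁ ≤ Λ' * ℓ₀ → ∀ η : ℝ, 0 ≤ η → η ≤ η₂ →
    ∀ W : Family a ℓ₀, (∀ᶠ k in atTop, AdmAt κ η a L β' ℓ₀ W k) →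
      ∃ φ : ℕ → ℕ, StrictMono φ ∧ ∃ (c m : YMSpecies SU3 → ℕ → ℝ) (T : OSData (YMSpecies SU3) 4),
        ClauseConv a L ha ha₀ haL β' ℓ₀ W φ c m T ∧ T.IsNontrivial r₃.curvature ∧
          T.IsNonGaussian r₃.curvature ∧ (∃ Δ' : ℝ, 0 < Δ' ∧ T.HasMassGap Δ') ∧
          ClauseLipOff κ η a L ha ha₀ haL β' ℓ₀ W c m

/-! ## The zero family and the cone's vertex -/

/-- **`W ≡ 0` is admissible, eventually in `k`**, at every `(κ, η)` with `η ≥ 0` and every block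
scale: (h1) the total of `0` is `0`; (h2) odd-torus reflection positivity of Wilson's `SU(3)` measure
(`isReflectionPositive_zero_all`) at `β'_k ≥ 0`, which holds eventually along every a.f. coupling
sequence (`eventually_nonneg_of_af`); (h3) `‖0‖ ≤ η` (`normLE_zero`); (h4) vacuous (`0` has no
non-zero activity). Private copy of `eventually_admAt_zero` of the sibling module
`NestedDissectionSeaRobustYangMillsUVRiderSize` (landed concurrently; one name, one module). -/
private theorem eventually_admAt_zeroFamily (κ : ℝ) {η : ℝ} (hη : 0 ≤ η) {a : ℕ → ℝ} (L : ℕ → ℕ)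
    (ha : ∀ k, 0 < a k) (ha₀ : Tendsto a atTop (𝓝 0)) {β' : ℕ → ℝ} {Λ' : ℝ} (hΛ' : 0 < Λ')
    (hβ' : Tendsto (fun k => β' k - afBeta 0 Λ' (a k)) atTop (𝓝 0)) (ℓ₀ : ℝ) :
    ∀ᶠ k in atTop, AdmAt κ η a L β' ℓ₀ (fun _ _ => 0) k := by
  filter_upwards [eventually_nonneg_of_af ha ha₀ hΛ' hβ'] with k hk S _
  refine ⟨fun v U => by simp, fun U => by simp, fun π U => by simp,
    isReflectionPositive_zero_all ρ₃ (continuous_fundamentalRep _) S _ hk,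
    QuasiLocalGaugePerturbation.normLE_zero hη, ?_⟩
  rintro X - ⟨U, hU⟩
  simp at hU

/-- **The clustering hypothesis at the cone's vertex.** Uniform IR clustering of the cone at
`(η₁, κ, c₁)`, `η₁ ≥ 0`, read at `w = 0` (`normLE_zero`, range control vacuous, total `0`
translation invariant; `connectedCorr_zero`), is the uniform lattice mass gap `HasLatticeMassGap` of
the pure `SU(3)` Wilson theory along the scheme `(a, β', L)` (any renormalisations `c, m`), for every
a.f. coupling sequence, as soon as ONE block scale lies in the IR regime `c₁ ≤ Λ'ℓ₀`. -/
theorem hasLatticeMassGap_of_irConeClustering {η₁ κ c₁ : ℝ} (hη₁ : 0 ≤ η₁)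
    (hclu : IRConeClustering η₁ κ c₁) (a : ℕ → ℝ) (L : ℕ → ℕ) (ha : ∀ k, 0 < a k)
    (ha₀ : Tendsto a atTop (𝓝 0)) (haL : Tendsto (fun k => a k * L k) atTop atTop) (β' : ℕ → ℝ)
    {Λ' : ℝ} (hΛ' : 0 < Λ') (hβ' : Tendsto (fun k => β' k - afBeta 0 Λ' (a k)) atTop (𝓝 0))
    {ℓ₀ : ℝ} (hℓ₀ : c₁ ≤ Λ' * ℓ₀) (c m : YMSpecies SU3 → ℕ → ℝ) :
    ∃ Δ : ℝ, 0 < Δ ∧ HasLatticeMassGap r₃ (sch a L ha ha₀ haL β' c m) Δ := by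
  obtain ⟨Δ, hΔ, h⟩ := hclu a L ha ha₀ haL β' Λ' hΛ' hβ' ℓ₀ hℓ₀
  refine ⟨Δ, hΔ, fun A B => ?_⟩
  obtain ⟨C, hC⟩ := h A B
  refine ⟨C, ?_⟩
  filter_upwards [hC] with k hk S hS n hn
  have h0 := hk S hS 0 (QuasiLocalGaugePerturbation.normLE_zero hη₁)
    (by rintro X - ⟨U, hU⟩; simp at hU) (fun v U => by simp) n hn
  rwa [QuasiLocalGaugePerturbation.connectedCorr_zero] at h0

/-- **Monotonicity of the leg's hypothesis.** Uniform IR clustering of the cone is antitone in the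
budget `η₁` and monotone in the decay rate `κ` (both shrink the cone: `NormLE.mono`, `NormLE.anti`)
and monotone in the IR scale `c₁` (fewer block scales qualify) — the reconciliation of constants
under which the leg's hypothesis at `(η₁, κ, c₁)` serves every `(η₁' ≤ η₁, κ' ≥ κ, c₁' ≥ c₁)`. -/
theorem IRConeClustering.mono {η₁ η₁' κ κ' c₁ c₁' : ℝ} (h : IRConeClustering η₁ κ c₁)
    (hη : η₁' ≤ η₁) (hκ : κ ≤ κ') (hc : c₁ ≤ c₁') : IRConeClustering η₁' κ' c₁' := by
  intro a L ha ha₀ haL β' Λ' hΛ' hβ' ℓ₀ hℓ₀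
  obtain ⟨Δ, hΔ, hAB⟩ := h a L ha ha₀ haL β' Λ' hΛ' hβ' ℓ₀ (hc.trans hℓ₀)
  refine ⟨Δ, hΔ, fun A B => ?_⟩
  obtain ⟨C, hC⟩ := hAB A B
  exact ⟨C, hC.mono fun k hk S hS w hw hrc hinv t ht =>
    hk S hS w ((hw.anti hκ).mono hη) hrc hinv t ht⟩

/-! ## Antitonicity of the two gaps in the rate -/

/-- The OS mass-gap predicate of OS data is antitone in the rate (`t ≥ 0`; constant `max C 0`). -/
theorem osMassGap_anti {ι : Type} {d : ℕ} [NeZero d] (T : OSData ι d) {Δ Δ' : ℝ} (hΔ' : Δ' ≤ Δ)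
    (h : T.HasMassGap Δ) : T.HasMassGap Δ' := by
  intro n m k k' F G' hF hG
  obtain ⟨C, hC⟩ := h n m k k' F G' hF hG
  refine ⟨max C 0, fun t ht H hH => (hC t ht H hH).trans ?_⟩
  calc C * Real.exp (-Δ * t) ≤ max C 0 * Real.exp (-Δ * t) :=
        mul_le_mul_of_nonneg_right (le_max_left _ _) (Real.exp_pos _).le
    _ ≤ max C 0 * Real.exp (-Δ' * t) :=
        mul_le_mul_of_nonneg_left (Real.exp_le_exp.2 (by nlinarith)) (le_max_right _ _)

/-- The uniform lattice mass gap of an `SU(3)` species scheme is antitone in the rate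
(`a_k n ≥ 0`; constant `max C 0`). -/
theorem latticeMassGap_anti {S₀ : SpeciesScheme (YMSpecies SU3)} {Δ Δ' : ℝ} (hΔ' : Δ' ≤ Δ)
    (h : HasLatticeMassGap r₃ S₀ Δ) : HasLatticeMassGap r₃ S₀ Δ' := by
  intro A B
  obtain ⟨C, hC⟩ := h A B
  refine ⟨max C 0, ?_⟩
  filter_upwards [hC] with k hk S hS n hn
  refine (hk S hS n hn).trans ?_
  have ha : 0 ≤ S₀.a k * n := mul_nonneg (S₀.a_pos k).le (Nat.cast_nonneg n)
  calc C * Real.exp (-(Δ * (S₀.a k * n)))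
      ≤ max C 0 * Real.exp (-(Δ * (S₀.a k * n))) :=
        mul_le_mul_of_nonneg_right (le_max_left _ _) (Real.exp_pos _).le
    _ ≤ max C 0 * Real.exp (-(Δ' * (S₀.a k * n))) :=
        mul_le_mul_of_nonneg_left (Real.exp_le_exp.2 (by nlinarith)) (le_max_right _ _)

/-! ## The size of the leg -/

/-- **The leg contains the pure-Wilson OS continuum limit with gap (line's vocabulary).** Given
`RenormalisedLeg` and uniform IR clustering of the cone at any `(η₁, κ, c₁)` with `η₁, κ, c₁ > 0`:
for all scaling data, every a.f. coupling sequence and EVERY block scale in the IR regime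
`c₁ ≤ Λ'ℓ₀`, the unperturbed family `W ≡ 0` has a subsequence `φ`, renormalisations `(c, m)` and OS
data `T` with clause (i′) (convergence of all renormalised species on `⁰𝒮`), (ii) non-trivial
non-Gaussian curvature, and an OS mass gap — the leg instantiated at `η = 0`, `W ≡ 0`
(`eventually_admAt_zeroFamily`). -/
theorem wilsonContinuum_of_renormalisedLeg_of_clustering (hE : RenormalisedLeg) {η₁ κ c₁ : ℝ}
    (hη₁ : 0 < η₁) (hκ : 0 < κ) (hc₁ : 0 < c₁) (hclu : IRConeClustering η₁ κ c₁)
    (a : ℕ → ℝ) (L : ℕ → ℕ) (ha : ∀ k, 0 < a k) (ha₀ : Tendsto a atTop (𝓝 0))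
    (haL : Tendsto (fun k => a k * L k) atTop atTop) (β' : ℕ → ℝ) (Λ' : ℝ) (hΛ' : 0 < Λ')
    (hβ' : Tendsto (fun k => β' k - afBeta 0 Λ' (a k)) atTop (𝓝 0)) (ℓ₀ : ℝ)
    (hℓ₀ : c₁ ≤ Λ' * ℓ₀) :
    ∃ φ : ℕ → ℕ, StrictMono φ ∧ ∃ (c m : YMSpecies SU3 → ℕ → ℝ) (T : OSData (YMSpecies SU3) 4),
      ClauseConv a L ha ha₀ haL β' ℓ₀ (fun _ _ => 0) φ c m T ∧ T.IsNontrivial r₃.curvature ∧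
        T.IsNonGaussian r₃.curvature ∧ ∃ Δ' : ℝ, 0 < Δ' ∧ T.HasMassGap Δ' := by
  obtain ⟨η₂, hη₂, -, hleg⟩ := hE η₁ κ c₁ hη₁ hκ hc₁ hclu
  obtain ⟨φ, hφ, c, m, T, hconv, hnt, hng, hgap, -⟩ :=
    hleg a L ha ha₀ haL β' Λ' hΛ' hβ' ℓ₀ hℓ₀ 0 le_rfl hη₂.le (fun _ _ => 0)
      (eventually_admAt_zeroFamily κ le_rfl L ha ha₀ hΛ' hβ' ℓ₀)
  exact ⟨φ, hφ, c, m, T, hconv, hnt, hng, hgap⟩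

/-- **The leg contains the crux's whole `W ≡ 0` content (tree's vocabulary).** `RenormalisedLeg`
together with uniform IR clustering of the cone at any `(η₁, κ, c₁)` with `η₁, κ, c₁ > 0` implies
`Negative.WilsonConsequences a L ha ha₀ haL β'` for ALL scaling data `(a, L)` and ALL a.f. coupling
sequences `β'` — the conclusion of `Negative.robustYangMills_imp_wilson`, there derived from the full
crux: a subsequential OS continuum limit `T` of all gauge-invariant species of the pure `SU(3)`
Wilson theory on `⁰𝒮`, non-trivial non-Gaussian curvature, and one rate `Δ > 0` that is both an OS
mass gap of `T` and a uniform lattice mass gap along the scheme. Proof: block scale `ℓ₀ := c₁/Λ'`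
(IR regime with equality); the leg at `η = 0`, `W ≡ 0` (`wilsonContinuum_of_renormalisedLeg_of_clustering`,
`perturbedLatticeSchwinger_zero`); the lattice gap from the clustering hypothesis at `w = 0`
(`hasLatticeMassGap_of_irConeClustering`); `Δ := min Δ_L Δ_T` by antitonicity. -/
theorem wilsonConsequences_of_renormalisedLeg_of_clustering (hE : RenormalisedLeg) {η₁ κ c₁ : ℝ}
    (hη₁ : 0 < η₁) (hκ : 0 < κ) (hc₁ : 0 < c₁) (hclu : IRConeClustering η₁ κ c₁)
    (a : ℕ → ℝ) (L : ℕ → ℕ) (ha : ∀ k, 0 < a k) (ha₀ : Tendsto a atTop (𝓝 0))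
    (haL : Tendsto (fun k => a k * L k) atTop atTop) (β' : ℕ → ℝ) (Λ' : ℝ) (hΛ' : 0 < Λ')
    (hβ' : Tendsto (fun k => β' k - afBeta 0 Λ' (a k)) atTop (𝓝 0)) :
    WilsonConsequences a L ha ha₀ haL β' := by
  -- the IR block scale `ℓ₀ := c₁ / Λ'`
  have hℓ₀ : c₁ ≤ Λ' * (c₁ / Λ') := (mul_div_cancel₀ c₁ hΛ'.ne').symm.le
  obtain ⟨φ, hφ, c, m, T, hconv, hnt, hng, Δ', hΔ', hgapT⟩ :=
    wilsonContinuum_of_renormalisedLeg_of_clustering hE hη₁ hκ hc₁ hclu a L ha ha₀ haL β' Λ' hΛ'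
      hβ' (c₁ / Λ') hℓ₀
  obtain ⟨Δ, hΔ, hgapL⟩ :=
    hasLatticeMassGap_of_irConeClustering hη₁.le hclu a L ha ha₀ haL β' hΛ' hβ' hℓ₀ c m
  refine ⟨φ, hφ, c, m, T, min Δ Δ', lt_min hΔ hΔ', fun n hn σ f F hF hF' => ?_, hnt, hng,
    osMassGap_anti T (min_le_right _ _) hgapT, latticeMassGap_anti (min_le_left _ _) hgapL⟩
  refine (hconv n hn σ f F hF hF').congr fun j => ?_
  exact congrArg (fun r : ℝ => (r : ℂ))
    (perturbedLatticeSchwinger_zero ρ₃ (sch a L ha ha₀ haL β' c m)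
      (bs := fun k => ⌊c₁ / Λ' / a k⌋₊) (fun s => s.F) (φ j) n σ f)

/-- **`stub_renormalisedLegSize`** — the registered SIZE sub-goal of the open stub
`stub_renormalisedLeg` (binder-explicit form of `wilsonConsequences_of_renormalisedLeg_of_clustering`):
the leg ∧ uniform IR clustering of the cone ⇒ `Negative.WilsonConsequences` (subsequential OS
continuum limit of pure `SU(3)` Wilson with non-trivial non-Gaussian curvature, OS gap and uniform
lattice gap) along every scaling sequence and every a.f. coupling sequence. -/
theorem stub_renormalisedLegSize : RenormalisedLeg → ∀ (η₁ κ c₁ : ℝ), 0 < η₁ → 0 < κ → 0 < c₁ → IRConeClustering η₁ κ c₁ → ∀ (a : ℕ → ℝ) (L : ℕ → ℕ) (ha : ∀ k, 0 < a k) (ha₀ : Tendsto a atTop (𝓝 0)) (haL : Tendsto (fun k => a k * L k) atTop atTop) (β' : ℕ → ℝ) (Λ' : ℝ), 0 < Λ' → Tendsto (fun k => β' k - afBeta 0 Λ' (a k)) atTop (𝓝 0) → Summit.QuantumFields.QCD.Theorems.RobustYangMills.Negative.WilsonConsequences a L ha ha₀ haL β' :=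
  fun hE _ _ _ hη₁ hκ hc₁ hclu a L ha ha₀ haL β' Λ' hΛ' hβ' =>
    wilsonConsequences_of_renormalisedLeg_of_clustering hE hη₁ hκ hc₁ hclu a L ha ha₀ haL β' Λ' hΛ' hβ'

end Summit.QuantumFields.QCD.Cruxes.RobustYangMills.LocalAcOpenCertificate

end
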